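import Summits.PneNP.Statement
import Literature.Computability.Complexity.CookBridges
import Literature.Computability.Complexity.TautMachine
import Literature.Computability.MetaComplexity.ProofSystemsProofs

/-!
# PneNP — `¬ HasPolyBoundedProofSystem TAUT → PneNP`, cycle-free and conjecture-free

The bridge "`TAUT` has no polynomially bounded Cook–Reckhow proof system ⟹ `P ≠ NP` (Cook's
form `PneNP`)", stated as a TERM over Literature vocabulary and the summit statement only — this
module imports NO route (`Theses`) file and only the conjecture-free Literature modules
`CookBridges`, `TautMachine`, `ProofSystemsProofs` (hence `Classes`, `Nondeterministic`,
`ProofSystems`), so that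

* route files can import it for their `_holds` links without an import cycle: the term is
  definitionally `Summit.PneNP.PneNP.Theses.ExpanderLinearGenerators.TautBridge`
  (stmt-PneNP-10249), `…AperiodicTorus.TautBridge`, and — after unfolding
  `NoPolyBoundedProofSystem` — the rev-6 assembly
  `Summit.PneNP.PneNP.Theses.ExpanderLinearGenerators.Assembly` (stmt-PneNP-15165); and
* the import cone of whoever uses it stays free of unproved named facts (contrast
  `Theorems/ExpanderLinearGeneratorsTautBridge.lean`, which proves the same term through
  `ClayProblem` / `ClayProblemProofs` / `ProofComplexityNP`).

Proof (Cook–Reckhow 1979, Prop. 1.1 with Prop. 1.4; Cook, Clay problem description §1): if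
`Classes.P = Nondeterministic.NP` then `coNP = co P = P = NP` (`co_P_holds`), so `TAUT ∈ coNP`
(`TAUT_mem_coNP_holds`) lies in `NP` and has a polynomially bounded proof system
(`hasPolyBoundedProofSystem_iff_mem_NP_holds`); and `Classes.P ≠ Nondeterministic.NP` is Cook's
statement by the model bridges (`pneNP_shape_of_P_ne_NP`). This is the argument of the deciding
theorems `closes` of routes `MatroidTseitin` and `LyapunovRefutations`, recorded once as a
reusable theorem.

References: S. A. Cook, R. A. Reckhow, *The relative efficiency of propositional proof systems*,
J. Symb. Logic 44 (1979), §1, Prop. 1.1 and Prop. 1.4; S. Cook, *The P versus NP problem* (Clay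
Mathematics Institute, 2000), §1; S. Arora, B. Barak, *Computational Complexity: A Modern Approach*
(2009), §2.6.1.
-/

set_option linter.dupNamespace false -- `Summit.PneNP.PneNP.…`: summit = sub-problem name (D-0017 single-conjunct layout)

namespace Summit.PneNP.PneNP.Theorems

/-- If `TAUT` has no polynomially bounded Cook–Reckhow proof system then `P ≠ NP` over the
prelude classes (`Classes.P ≠ Nondeterministic.NP`): were `P = NP`, then `coNP = co P = P = NP`
(`co_P_holds`), so `TAUT ∈ coNP` (`TAUT_mem_coNP_holds`) would lie in `NP` and have a polynomially
bounded proof system (Cook–Reckhow 1979, Prop. 1.4, `hasPolyBoundedProofSystem_iff_mem_NP_holds`).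
[cite: CookReckhow1979, §1 Prop. 1.1] -/
theorem classesP_ne_NP_of_not_hasPolyBoundedProofSystem_TAUT
    (hX : ¬ Literature.Computability.MetaComplexity.HasPolyBoundedProofSystem
      Literature.Computability.Complexity.TAUT) :
    Literature.Computability.Complexity.Classes.P ≠
      Literature.Computability.Complexity.Nondeterministic.NP := by
  intro hPNP
  apply hX
  have hT : Literature.Computability.Complexity.TAUT ∈ Literature.Computability.Complexity.coNP :=
    Literature.Computability.Complexity.TAUT_mem_coNP_holds
  have hco : Literature.Computability.Complexity.coNP =
      Literature.Computability.Complexity.Nondeterministic.NP := by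
    show Literature.Computability.Complexity.co
        Literature.Computability.Complexity.Nondeterministic.NP =
      Literature.Computability.Complexity.Nondeterministic.NP
    rw [← hPNP]
    exact Literature.Computability.Complexity.co_P_holds
  rw [hco] at hT
  exact Literature.Computability.MetaComplexity.hasPolyBoundedProofSystem_iff_mem_NP_holds.2 hT

/-- **`¬ HasPolyBoundedProofSystem TAUT → PneNP`** (the term of `TautBridge`, stmt-PneNP-10249, and
of the rev-6 `Assembly` of route ExpanderLinearGenerators, stmt-PneNP-15165; cycle-free and
conjecture-free): no polynomially bounded proof system for `TAUT` gives `P ≠ NP` over the prelude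
classes (`classesP_ne_NP_of_not_hasPolyBoundedProofSystem_TAUT`), which is Cook's statement
`PneNP` by the model bridges (`pneNP_shape_of_P_ne_NP`). [cite: CookReckhow1979, §1 Prop. 1.1] -/
theorem pneNP_of_not_hasPolyBoundedProofSystem_TAUT :
    ¬ Literature.Computability.MetaComplexity.HasPolyBoundedProofSystem
        Literature.Computability.Complexity.TAUT → PneNP := by
  intro hX
  obtain ⟨L, hL, hL'⟩ := Literature.Computability.Complexity.pneNP_shape_of_P_ne_NP
    (classesP_ne_NP_of_not_hasPolyBoundedProofSystem_TAUT hX)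
  exact ⟨L, hL, hL'⟩

end Summit.PneNP.PneNP.Theorems
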